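import Summits.HodgeConjecture.HodgeConjecture.Theorems.NikulinTwinTransportRealMultiplicationAnchorOfAlgebraic
import Literature.AlgebraicGeometry.HodgeTheory.CorrespondenceActionOfGraph
import Literature.AlgebraicGeometry.HodgeTheory.HodgeTypeExteriorProduct

/-!
# Route NikulinTwinTransport · crux `TwinTransportRMPicardTwo` (stmt-HodgeConjecture-15067) —
# the `ζ₈`-anchor species: an automorphism of order `8` on `T` makes real multiplication algebraic

The milestone asks, at every projective K3 surface of Picard rank `2` with real multiplication by
`√2` on `T = NS^⊥`, for an ALGEBRAIC anchor. The crux idea `zeta8-double-quadric-anchor` points at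
a species where the anchor comes for free: the double covers `w² = F` of `ℙ¹ × ℙ¹` branched along
a `(4,4)`-curve with `F(y,-x) = i·F(x,y)` carry `f = (y, -x, ζ₈ w)` of order `8`, swapping the
rulings and acting on `T` with `f⁴ = -1`, so that `√2 = f^* + (f^*)⁻¹` on `T` is induced by graphs
of automorphisms. This file proves the species statement for ANY projective K3 surface `S` with:

* automorphisms `φ`, `ψ` inverse to each other, `φ^*` trivial on `H⁴(S(ℂ); ℂ)`;
* two rational algebraic divisor classes `E₁, E₂` with `E₁² = E₂² = 0`, `E₁.E₂ ≠ 0`, spanning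
  `NS := algebraicClasses S 1` over `ℂ` and swapped by `φ^*`;
* `(φ^*)⁴ = -1` on `NS^⊥`.

Results (granted the three named K3 facts of the route, nothing else):

* `swapRealMultiplication_spec` — the endomorphism
  `e := φ^* + ψ^* - (2/(E₁.E₂)) ((·.E₁) E₁ + (·.E₂) E₂)` is rational, type-preserving,
  cup-self-adjoint, kills `NS`, satisfies `e (e x) = 2x` on `NS^⊥` (where `e = φ^* + ψ^*`), and IS
  ALGEBRAIC: `φ^* = [(𝟙, φ)₊1]_*`, `ψ^* = [(𝟙, ψ)₊1]_*` (push–pull of graph classes,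
  `exists_algebraic_corrAction_eq_of_pushPull`) and the corrections are divisor correspondences
  (`divisorCorrespondence_of_fibreIntegral`, fibre integral from the Künneth theorem).
* `rmAnchor_of_swapAutomorphism` — hence the CONCLUSION of `TwinTransportRMPicardTwo` holds at
  `S` (for every integral generator of `H⁴`), via seat 13679-1's
  `rmAnchor_at_of_realMultiplication_algebraic_at` (`S″ = S`, `Ψ = e + ν̃`).
* `finrank_algebraicClasses_eq_two_of_swap` — and `S` has Picard rank `2`, so `(S, e)` also
  satisfies the HYPOTHESES of the milestone: the species lies in its scope.
Not here: the existence of such `(S, φ, E₁, E₂)` (explicit double quadrics are not constructible in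
the tree; see the item's evidence `zeta8-anchor-instance.md`). Prover seat prover-…-NikulinTwinTransport-1.
References: [VanGeemenSchuett2023] arXiv:2310.05196 §2.3, §4.8, Rem. 4.9; [Fulton1998] §16.1
Prop. 16.1.1–16.1.2; [Huybrechts2016K3] Ch. 3 §3, Ch. 15 §1.
-/

noncomputable section

namespace Summit.HodgeConjecture.HodgeConjecture.Theorems.NikulinTwinTransport

open scoped Manifold
open CategoryTheory MonoidalCategory SemiCartesianMonoidalCategory
open Literature.AlgebraicGeometry.Motives Literature.AlgebraicGeometry.HodgeTheory
open Literature.AlgebraicGeometry.Surfaces Literature.Geometry.Kaehler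
open Literature.AlgebraicTopology.SingularHomology

variable {S : SchemeOver ℂ}

/-- **The `ζ₈`-anchor species: the real multiplication attached to a ruling-swapping
automorphism of order `8` on `T` is algebraic.** Let `S` be a projective K3 surface with
automorphisms `φ, ψ` inverse to each other (`φ^*` trivial on `H⁴`), rational algebraic divisor
classes `E₁, E₂` with `E₁² = E₂² = 0`, `E₁.E₂ ≠ 0` spanning `NS = algebraicClasses S 1` and
swapped by `φ^*`, and `(φ^*)⁴ = -1` on `NS^⊥`. Then
`e = φ^* + ψ^* - (2/(E₁.E₂))((·.E₁)E₁ + (·.E₂)E₂)` is rational, type-preserving,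
cup-self-adjoint, kills `NS`, has `e(ex) = 2x` and `e x = φ^*x + ψ^*x` for `x ⊥ NS`, and is
`[γ]_*` for an algebraic `γ` on `S × S` (graph classes of `φ, ψ` and divisor correspondences).
[cite: VanGeemenSchuett2023, §2.3 and §4.8] [cite: Fulton1998, §16.1 Prop. 16.1.1–16.1.2] -/
theorem swapRealMultiplication_spec
    (hmark : Huybrechts_K3_marking_exists) (hHT : Huybrechts_K3_hodgeTypes_H2)
    (hG : Grothendieck1969_supportedClasses_le_hodgeConiveau)
    (μ : OrientationFamily) (hμ : μ.HasPoincareDuality) (hS : IsK3Surface S)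
    (φ ψ : S ⟶ S) (hφψ : φ ≫ ψ = 𝟙 S) (hψφ : ψ ≫ φ = 𝟙 S)
    (hφtop : ∀ z : complexBetti S (2 * 2), complexBetti.map φ (2 * 2) z = z)
    (E₁ E₂ : complexBetti S (2 * 1)) (hE₁ : E₁ ∈ algebraicClasses S 1)
    (hE₂ : E₂ ∈ algebraicClasses S 1) (hE₁r : IsRationalClass E₁) (hE₂r : IsRationalClass E₂)
    (h11 : cupProduct (rfl : 2 * 1 + 2 * 1 = 2 * 2) E₁ E₁ = 0)
    (h22 : cupProduct (rfl : 2 * 1 + 2 * 1 = 2 * 2) E₂ E₂ = 0)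
    (h12 : cupProduct (rfl : 2 * 1 + 2 * 1 = 2 * 2) E₁ E₂ ≠ 0)
    (hspan : ∀ d ∈ algebraicClasses S 1, ∃ a b : ℂ, d = a • E₁ + b • E₂)
    (hφE₁ : complexBetti.map φ (2 * 1) E₁ = E₂) (hφE₂ : complexBetti.map φ (2 * 1) E₂ = E₁)
    (hT : ∀ x : complexBetti S (2 * 1),
      (∀ d ∈ algebraicClasses S 1, cupProduct (rfl : 2 * 1 + 2 * 1 = 2 * 2) x d = 0) →
        complexBetti.map φ (2 * 1) (complexBetti.map φ (2 * 1)
          (complexBetti.map φ (2 * 1) (complexBetti.map φ (2 * 1) x))) = -x) :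
    ∃ e : complexBetti S (2 * 1) →ₗ[ℂ] complexBetti S (2 * 1),
      (∀ x, IsRationalClass x → IsRationalClass (e x)) ∧
      (∀ (i j : ℕ) x, IsOfHodgeType 2 S (2 * 1) i j x → IsOfHodgeType 2 S (2 * 1) i j (e x)) ∧
      (∀ x y : complexBetti S (2 * 1), cupProduct (rfl : 2 * 1 + 2 * 1 = 2 * 2) (e x) y =
        cupProduct (rfl : 2 * 1 + 2 * 1 = 2 * 2) x (e y)) ∧
      (∀ d ∈ algebraicClasses S 1, e d = 0) ∧
      (∀ x : complexBetti S (2 * 1),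
        (∀ d ∈ algebraicClasses S 1, cupProduct (rfl : 2 * 1 + 2 * 1 = 2 * 2) x d = 0) →
          e (e x) = (2 : ℂ) • x) ∧
      (∃ γ ∈ algebraicClasses (S ⊗ S) 2, ∀ x : complexBetti S (2 * 1),
        e x = complexGysin μ (IsSmoothProjective.tensor_holds hS.1 hS.1) hS.1 (fst S S)
          (rfl : 2 * 1 + 2 * 2 + 2 * 2 = 2 * 1 + 2 * (2 + 2))
          (cupProduct (rfl : 2 * 1 + 2 * 2 = 2 * 1 + 2 * 2)
            (complexBetti.map (snd S S) (2 * 1) x) γ)) ∧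
      (∀ x : complexBetti S (2 * 1),
        (∀ d ∈ algebraicClasses S 1, cupProduct (rfl : 2 * 1 + 2 * 1 = 2 * 2) x d = 0) →
          e x = complexBetti.map φ (2 * 1) x + complexBetti.map ψ (2 * 1) x) := by
  classical
  set N := algebraicClasses S 1 with hNdef
  -- the pull-backs as linear maps, inverse to each other
  set Φ : complexBetti S (2 * 1) →ₗ[ℂ] complexBetti S (2 * 1) := (complexBetti.map φ (2 * 1)).hom
    with hΦdef
  set Ψ : complexBetti S (2 * 1) →ₗ[ℂ] complexBetti S (2 * 1) := (complexBetti.map ψ (2 * 1)).hom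
    with hΨdef
  have hΦapp : ∀ x, Φ x = complexBetti.map φ (2 * 1) x := fun x => rfl
  have hΨapp : ∀ x, Ψ x = complexBetti.map ψ (2 * 1) x := fun x => rfl
  have hΦΨ : ∀ x, Φ (Ψ x) = x := fun x => by
    rw [hΦapp, hΨapp, ← ModuleCat.comp_apply, ← complexBetti.map_comp, hφψ, complexBetti.map_id,
      ModuleCat.id_apply]
  have hΨΦ : ∀ x, Ψ (Φ x) = x := fun x => by
    rw [hΦapp, hΨapp, ← ModuleCat.comp_apply, ← complexBetti.map_comp, hψφ, complexBetti.map_id,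
      ModuleCat.id_apply]
  have hΦE₁ : Φ E₁ = E₂ := hφE₁
  have hΦE₂ : Φ E₂ = E₁ := hφE₂
  have hΨE₁ : Ψ E₁ = E₂ := by rw [← hΦE₂, hΨΦ]
  have hΨE₂ : Ψ E₂ = E₁ := by rw [← hΦE₁, hΨΦ]
  have hT' : ∀ x : complexBetti S (2 * 1), (∀ d ∈ N, cupProduct (rfl : 2 * 1 + 2 * 1 = 2 * 2) x d = 0) →
      Φ (Φ (Φ (Φ x))) = -x := hT
  -- a marking: the cup form `B x y = (ηx.ηy)`, `x ∪ y = B x y • p₀`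
  obtain ⟨η, p₀, x₀, hp₀, ⟨-, -, hηint, hηcup, h20, -⟩, ⟨hx00, hxpos, -⟩⟩ := hmark S hS
  have hσ0 : η.symm x₀ ≠ 0 := fun h0 =>
    ne_zero_of_star_self_re_pos hxpos (by simpa using congrArg η h0)
  obtain ⟨h1, h2, h3⟩ := hHT S hS (η.symm x₀) h20 hσ0
  rw [conjClass_marking_symm η hηint] at h2 h3
  obtain ⟨A⟩ := hS.nonempty_hodgeModel
  have hsmul : ∀ {c c' : ℂ}, c • p₀ = c' • p₀ → c = c' := fun h => smul_left_injective ℂ hp₀ h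
  set B : LinearMap.BilinForm ℂ (complexBetti S (2 * 1)) :=
    k3FormC.compl₁₂ η.toLinearMap η.toLinearMap with hBdef
  have hB : ∀ x y, B x y = k3Form (η x) (η y) := fun x y => by
    simp only [hBdef, LinearMap.compl₁₂_apply, LinearEquiv.coe_coe, k3FormC_apply]
  have hcupB : ∀ x y, cupProduct (rfl : 2 * 1 + 2 * 1 = 2 * 2) x y = B x y • p₀ := fun x y => by
    rw [hB, hηcup]
  have hBsymm : ∀ x y, B x y = B y x := fun x y => by rw [hB, hB, k3Form_comm]
  have hcup0 : ∀ {x y}, cupProduct (rfl : 2 * 1 + 2 * 1 = 2 * 2) x y = 0 ↔ B x y = 0 := by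
    intro x y
    rw [hcupB, smul_eq_zero, or_iff_left hp₀]
  -- `Φ` is an isometry (`φ^*` is multiplicative and trivial on `H⁴`), hence so is `Ψ`
  have hiso : ∀ x y, B (Φ x) (Φ y) = B x y := by
    intro x y
    apply hsmul
    rw [← hcupB, ← hcupB, hΦapp, hΦapp, ← cupProduct_map]
    exact hφtop _
  have hisoΨ : ∀ x y, B (Ψ x) y = B x (Φ y) := fun x y => by
    rw [← hiso (Ψ x) y, hΦΨ]
  have hisoΦ : ∀ x y, B (Φ x) y = B x (Ψ y) := fun x y => by
    conv_lhs => rw [← hΦΨ y]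
    rw [hiso]
  -- the divisor data: `g = E₁.E₂ ≠ 0`, `E₁² = E₂² = 0`
  set g : ℂ := B E₁ E₂ with hgdef
  have hg : g ≠ 0 := fun h0 => h12 (hcup0.2 h0)
  have hB11 : B E₁ E₁ = 0 := hcup0.1 h11
  have hB22 : B E₂ E₂ = 0 := hcup0.1 h22
  have hB21 : B E₂ E₁ = g := by rw [hBsymm]
  -- orthogonality to `N` means orthogonality to `E₁` and `E₂`
  have horth : ∀ x, (∀ d ∈ N, cupProduct (rfl : 2 * 1 + 2 * 1 = 2 * 2) x d = 0) ↔
      B x E₁ = 0 ∧ B x E₂ = 0 := by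
    intro x
    refine ⟨fun h => ⟨hcup0.1 (h E₁ hE₁), hcup0.1 (h E₂ hE₂)⟩, fun h d hd => ?_⟩
    obtain ⟨a, b, rfl⟩ := hspan d hd
    rw [hcup0, map_add, map_smul, map_smul, h.1, h.2, smul_zero, smul_zero, add_zero]
  -- the corrections `Cᵢ x = (x.Eᵢ) Eᵢ` and the endomorphism `e`
  set C₁ : complexBetti S (2 * 1) →ₗ[ℂ] complexBetti S (2 * 1) := (B.flip E₁).smulRight E₁ with hC₁def
  set C₂ : complexBetti S (2 * 1) →ₗ[ℂ] complexBetti S (2 * 1) := (B.flip E₂).smulRight E₂ with hC₂def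
  have hC₁ : ∀ x, C₁ x = B x E₁ • E₁ := fun x => by
    rw [hC₁def, LinearMap.smulRight_apply, LinearMap.BilinForm.flip_apply]
  have hC₂ : ∀ x, C₂ x = B x E₂ • E₂ := fun x => by
    rw [hC₂def, LinearMap.smulRight_apply, LinearMap.BilinForm.flip_apply]
  set e : complexBetti S (2 * 1) →ₗ[ℂ] complexBetti S (2 * 1) := Φ + Ψ - (2 / g) • (C₁ + C₂)
    with hedef
  have he : ∀ x, e x = Φ x + Ψ x - (2 / g) • (B x E₁ • E₁ + B x E₂ • E₂) := fun x => by
    rw [hedef, LinearMap.sub_apply, LinearMap.add_apply, LinearMap.smul_apply, LinearMap.add_apply,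
      hC₁, hC₂]
  -- (T) on `NS^⊥`: `e = Φ + Ψ`
  have heT : ∀ x, B x E₁ = 0 → B x E₂ = 0 → e x = Φ x + Ψ x := fun x h₁ h₂ => by
    rw [he, h₁, h₂, zero_smul, zero_smul, add_zero, smul_zero, sub_zero]
  -- (N) `e` kills `E₁`, `E₂`, hence `N`
  have heE₁ : e E₁ = 0 := by
    rw [he, hΦE₁, hΨE₁, hB11, zero_smul, zero_add, smul_smul, div_mul_cancel₀ _ hg, two_smul,
      sub_self]
  have heE₂ : e E₂ = 0 := by
    rw [he, hΦE₂, hΨE₂, hB22, hB21, zero_smul, add_zero, smul_smul, div_mul_cancel₀ _ hg,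
      two_smul, sub_self]
  have heN : ∀ d ∈ N, e d = 0 := fun d hd => by
    obtain ⟨a, b, rfl⟩ := hspan d hd
    rw [map_add, map_smul, map_smul, heE₁, heE₂, smul_zero, smul_zero, add_zero]
  refine ⟨e, ?_, ?_, ?_, heN, ?_, ?_, fun x hx => heT x ((horth x).1 hx).1 ((horth x).1 hx).2⟩
  · -- (R) rationality
    intro x hx
    obtain ⟨w, hw⟩ := (isRationalClass_iff_of_marking hS η hηint x).1 hx
    obtain ⟨u₁, hu₁⟩ := (isRationalClass_iff_of_marking hS η hηint E₁).1 hE₁r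
    obtain ⟨u₂, hu₂⟩ := (isRationalClass_iff_of_marking hS η hηint E₂).1 hE₂r
    have hg' : g = ((k3FormRat u₁ u₂ : ℚ) : ℂ) := by rw [hgdef, hB, hu₁, hu₂, k3Form_ratCast]
    have hr₁ : B x E₁ = ((k3FormRat w u₁ : ℚ) : ℂ) := by rw [hB, hw, hu₁, k3Form_ratCast]
    have hr₂ : B x E₂ = ((k3FormRat w u₂ : ℚ) : ℂ) := by rw [hB, hw, hu₂, k3Form_ratCast]
    have hcorr : (2 / g) • (B x E₁ • E₁ + B x E₂ • E₂) =
        (((2 / k3FormRat u₁ u₂ * k3FormRat w u₁ : ℚ)) : ℂ) • E₁ +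
          (((2 / k3FormRat u₁ u₂ * k3FormRat w u₂ : ℚ)) : ℂ) • E₂ := by
      rw [smul_add, smul_smul, smul_smul, hg', hr₁, hr₂]
      push_cast
      rfl
    rw [he, hcorr]
    have hneg : ∀ c : complexBetti S (2 * 1), -c = ((-1 : ℚ) : ℂ) • c := fun c => by
      rw [Rat.cast_neg, Rat.cast_one, neg_one_smul]
    rw [sub_eq_add_neg, hneg]
    exact ((hx.map _).add (hx.map _)).add (((hE₁r.smul _).add (hE₂r.smul _)).smul _)
  · -- (H) Hodge types
    have hN11 : ∀ d ∈ N, IsOfHodgeType 2 S (2 * 1) 1 1 d :=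
      fun d hd => isOfHodgeType_oneOne_of_mem_algebraicClasses hG hS hd
    have hE₁σ : B (η.symm x₀) E₁ = 0 := by
      rw [hBsymm]; exact hcup0.1 ((h3 E₁).1 (hN11 E₁ hE₁)).1
    have hE₂σ : B (η.symm x₀) E₂ = 0 := by
      rw [hBsymm]; exact hcup0.1 ((h3 E₂).1 (hN11 E₂ hE₂)).1
    have hE₁σ' : B (η.symm (star x₀)) E₁ = 0 := by
      rw [hBsymm]; exact hcup0.1 ((h3 E₁).1 (hN11 E₁ hE₁)).2
    have hE₂σ' : B (η.symm (star x₀)) E₂ = 0 := by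
      rw [hBsymm]; exact hcup0.1 ((h3 E₂).1 (hN11 E₂ hE₂)).2
    have hΦtype : ∀ (i j : ℕ) y, IsOfHodgeType 2 S (2 * 1) i j y → IsOfHodgeType 2 S (2 * 1) i j (Φ y) :=
      fun i j y hy => IsOfHodgeType.map_of_isSmoothProjective hy hS.1 hS.1 φ
    have hΨtype : ∀ (i j : ℕ) y, IsOfHodgeType 2 S (2 * 1) i j y → IsOfHodgeType 2 S (2 * 1) i j (Ψ y) :=
      fun i j y hy => IsOfHodgeType.map_of_isSmoothProjective hy hS.1 hS.1 ψ
    intro i j y hy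
    by_cases hij : i + j = 2 * 1
    · obtain ⟨rfl, rfl⟩ | ⟨rfl, rfl⟩ | ⟨rfl, rfl⟩ :
          (i = 2 ∧ j = 0) ∨ (i = 0 ∧ j = 2) ∨ (i = 1 ∧ j = 1) := by omega
      · obtain ⟨t, ht⟩ := (h1 y).1 hy
        have hy0 : B y E₁ = 0 ∧ B y E₂ = 0 := by
          rw [ht, map_smul, LinearMap.smul_apply, LinearMap.smul_apply, hE₁σ, hE₂σ, smul_zero]
          exact ⟨rfl, rfl⟩
        rw [heT y hy0.1 hy0.2]
        exact (hΦtype 2 0 y hy).add hS.1 (hΨtype 2 0 y hy)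
      · obtain ⟨t, ht⟩ := (h2 y).1 hy
        have hy0 : B y E₁ = 0 ∧ B y E₂ = 0 := by
          rw [ht, map_smul, LinearMap.smul_apply, LinearMap.smul_apply, hE₁σ', hE₂σ', smul_zero]
          exact ⟨rfl, rfl⟩
        rw [heT y hy0.1 hy0.2]
        exact (hΦtype 0 2 y hy).add hS.1 (hΨtype 0 2 y hy)
      · rw [he]
        exact ((hΦtype 1 1 y hy).add hS.1 (hΨtype 1 1 y hy)).sub hS.1
          ((((hN11 E₁ hE₁).smul _).add hS.1 ((hN11 E₂ hE₂).smul _)).smul _)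
    · obtain rfl := isOfHodgeType_eq_zero_of_add_ne hy hij
      rw [map_zero]
      exact IsOfHodgeType.zero A _ _ _
  · -- (A) self-adjointness
    intro x y
    rw [hcupB, hcupB]
    congr 1
    rw [he x, he y]
    simp only [map_add, map_sub, map_smul, LinearMap.add_apply, LinearMap.sub_apply,
      LinearMap.smul_apply, smul_eq_mul]
    rw [hisoΦ x y, hisoΨ x y, hBsymm E₁ y, hBsymm E₂ y]
    ring
  · -- (T2) `e (e x) = 2 x` on `NS^⊥`
    intro x hx
    obtain ⟨hx₁, hx₂⟩ := (horth x).1 hx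
    have hΦx₁ : B (Φ x) E₁ = 0 := by rw [← hΦE₂, hiso, hx₂]
    have hΦx₂ : B (Φ x) E₂ = 0 := by rw [← hΦE₁, hiso, hx₁]
    have hΨx₁ : B (Ψ x) E₁ = 0 := by rw [hisoΨ, hΦE₁, hx₂]
    have hΨx₂ : B (Ψ x) E₂ = 0 := by rw [hisoΨ, hΦE₂, hx₁]
    have hΨΨ : Ψ (Ψ x) = -Φ (Φ x) := by
      have h4 := congrArg (fun z => Ψ (Ψ z)) (hT' x hx)
      simp only [hΨΦ, map_neg] at h4
      rw [h4, neg_neg]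
    rw [heT x hx₁ hx₂, map_add, heT _ hΦx₁ hΦx₂, heT _ hΨx₁ hΨx₂, hΨΦ, hΦΨ, hΨΨ, two_smul]
    abel
  · -- (G) algebraicity: graph classes for `Φ`, `Ψ`; divisor correspondences for `C₁`, `C₂`
    have hΦind : ∃ γ ∈ algebraicClasses (S ⊗ S) 2, ∀ x : complexBetti S (2 * 1),
        Φ x = complexGysin μ (IsSmoothProjective.tensor_holds hS.1 hS.1) hS.1 (fst S S)
          (rfl : 2 * 1 + 2 * 2 + 2 * 2 = 2 * 1 + 2 * (2 + 2))
          (cupProduct (rfl : 2 * 1 + 2 * 2 = 2 * 1 + 2 * 2)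
            (complexBetti.map (snd S S) (2 * 1) x) γ) := by
      obtain ⟨γ, hγ, hact⟩ := exists_algebraic_corrAction_eq_of_pushPull hμ hS.1 (T := Φ)
        ⟨S, hS.1, 𝟙 S, φ, 1, by rw [one_smul, complexGysin_id hμ hS.1, LinearMap.id_comp]⟩
      exact ⟨γ, hγ, fun x => by rw [← hact]; rfl⟩
    have hΨind : ∃ γ ∈ algebraicClasses (S ⊗ S) 2, ∀ x : complexBetti S (2 * 1),
        Ψ x = complexGysin μ (IsSmoothProjective.tensor_holds hS.1 hS.1) hS.1 (fst S S)
          (rfl : 2 * 1 + 2 * 2 + 2 * 2 = 2 * 1 + 2 * (2 + 2))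
          (cupProduct (rfl : 2 * 1 + 2 * 2 = 2 * 1 + 2 * 2)
            (complexBetti.map (snd S S) (2 * 1) x) γ) := by
      obtain ⟨γ, hγ, hact⟩ := exists_algebraic_corrAction_eq_of_pushPull hμ hS.1 (T := Ψ)
        ⟨S, hS.1, 𝟙 S, ψ, 1, by rw [one_smul, complexGysin_id hμ hS.1, LinearMap.id_comp]⟩
      exact ⟨γ, hγ, fun x => by rw [← hact]; rfl⟩
    obtain ⟨c, hc, hκ⟩ := fibreIntegral_of_kunnethTop μ hS.1 hS.1
      (kunnethSpan_complexBetti hS.1 hS.1 (2 * (2 + 2))) hp₀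
    have hCind : ∀ {E : complexBetti S (2 * 1)}, E ∈ N →
        ∃ γ ∈ algebraicClasses (S ⊗ S) 2, ∀ x : complexBetti S (2 * 1),
          ((B.flip E).smulRight E) x =
            complexGysin μ (IsSmoothProjective.tensor_holds hS.1 hS.1) hS.1 (fst S S)
              (rfl : 2 * 1 + 2 * 2 + 2 * 2 = 2 * 1 + 2 * (2 + 2))
              (cupProduct (rfl : 2 * 1 + 2 * 2 = 2 * 1 + 2 * 2)
                (complexBetti.map (snd S S) (2 * 1) x) γ) := by
      intro E hE
      obtain ⟨γ, hγ, hγeq⟩ := divisorCorrespondence_of_fibreIntegral μ hμ S hS p₀ c hc hκ hE hE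
      refine ⟨γ, hγ, fun x => ?_⟩
      rw [LinearMap.smulRight_apply, LinearMap.BilinForm.flip_apply]
      exact (hγeq x _ (hcupB x E)).symm
    have h := induced_sub (IsSmoothProjective.tensor_holds hS.1 hS.1) hS.1
      (rfl : 2 * 1 + 2 * 2 = 2 * 1 + 2 * 2) (rfl : 2 * 1 + 2 * 2 + 2 * 2 = 2 * 1 + 2 * (2 + 2))
      (induced_add (IsSmoothProjective.tensor_holds hS.1 hS.1) hS.1
        (rfl : 2 * 1 + 2 * 2 = 2 * 1 + 2 * 2) (rfl : 2 * 1 + 2 * 2 + 2 * 2 = 2 * 1 + 2 * (2 + 2))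
        hΦind hΨind)
      (induced_smul (IsSmoothProjective.tensor_holds hS.1 hS.1) hS.1
        (rfl : 2 * 1 + 2 * 2 = 2 * 1 + 2 * 2) (rfl : 2 * 1 + 2 * 2 + 2 * 2 = 2 * 1 + 2 * (2 + 2))
        (2 / g)
        (induced_add (IsSmoothProjective.tensor_holds hS.1 hS.1) hS.1
          (rfl : 2 * 1 + 2 * 2 = 2 * 1 + 2 * 2) (rfl : 2 * 1 + 2 * 2 + 2 * 2 = 2 * 1 + 2 * (2 + 2))
          (hCind hE₁) (hCind hE₂)))
    rw [← hC₁def, ← hC₂def, ← hedef] at h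
    exact h

/-- **Picard rank two.** Under the divisor hypotheses of `swapRealMultiplication_spec`
(`E₁, E₂ ∈ NS` isotropic with `E₁.E₂ ≠ 0` spanning `NS = algebraicClasses S 1`),
`finrank_ℂ NS = 2`. [cite: Huybrechts2016K3, Ch. 1 §2 (the hyperbolic plane)] -/
theorem finrank_algebraicClasses_eq_two_of_swap
    (E₁ E₂ : complexBetti S (2 * 1)) (hE₁ : E₁ ∈ algebraicClasses S 1)
    (hE₂ : E₂ ∈ algebraicClasses S 1)
    (h11 : cupProduct (rfl : 2 * 1 + 2 * 1 = 2 * 2) E₁ E₁ = 0)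
    (h12 : cupProduct (rfl : 2 * 1 + 2 * 1 = 2 * 2) E₁ E₂ ≠ 0)
    (hspan : ∀ d ∈ algebraicClasses S 1, ∃ a b : ℂ, d = a • E₁ + b • E₂) :
    Module.finrank ℂ ↥(algebraicClasses S 1) = 2 := by
  classical
  have h21 : cupProduct (rfl : 2 * 1 + 2 * 1 = 2 * 2) E₂ E₁ ≠ 0 := fun h => h12 (by
    rw [cupProduct_gradedComm_holds ℂ _ (rfl : 2 * 1 + 2 * 1 = 2 * 2) rfl, h, smul_zero])
  have hE₁0 : E₁ ≠ 0 := fun h0 => h12 (by rw [h0, map_zero, LinearMap.zero_apply])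
  have hli : LinearIndependent ℂ ![E₁, E₂] := by
    refine LinearIndependent.pair_iff.2 fun s t hst => ?_
    have ht : t = 0 := by
      have h := congrArg (fun z => cupProduct (rfl : 2 * 1 + 2 * 1 = 2 * 2) z E₁) hst
      simp only [map_add, map_smul, LinearMap.add_apply, LinearMap.smul_apply, map_zero,
        LinearMap.zero_apply, h11, smul_zero, zero_add, smul_eq_zero] at h
      exact h.resolve_right h21
    subst ht
    rw [zero_smul, add_zero, smul_eq_zero] at hst
    exact ⟨hst.resolve_right hE₁0, rfl⟩
  have hspan' : algebraicClasses S 1 = Submodule.span ℂ (Set.range ![E₁, E₂]) := by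
    apply le_antisymm
    · intro d hd
      obtain ⟨a, b, rfl⟩ := hspan d hd
      refine Submodule.add_mem _ (Submodule.smul_mem _ _ (Submodule.subset_span ⟨0, rfl⟩))
        (Submodule.smul_mem _ _ (Submodule.subset_span ⟨1, rfl⟩))
    · rw [Submodule.span_le]
      rintro _ ⟨i, rfl⟩
      fin_cases i
      · simpa using hE₁
      · simpa using hE₂
  rw [hspan', finrank_span_eq_card hli]
  rfl

/-- **The conclusion of the milestone `TwinTransportRMPicardTwo` holds at every projective K3
surface of the `ζ₈`-anchor species** (`φ, ψ` inverse automorphisms, `φ^*` trivial on `H⁴`,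
rational algebraic `E₁, E₂` with `E₁² = E₂² = 0 ≠ E₁.E₂` spanning `NS` and swapped by `φ^*`,
`(φ^*)⁴ = -1` on `NS^⊥`), granted the three named K3 facts: for every integral generator `p` of
`H⁴(S(ℂ))` there are a projective K3 partner (namely `S`), a generator `p″` and an ALGEBRAIC
`ℂ`-linear equivalence `Ψ : H²(S″) ≃ H²(S)` whose inverse is rational, type-preserving and halves
the cup form. Proof: the real multiplication `e` of `swapRealMultiplication_spec` is algebraic, so
`S″ := S`, `Ψ := e + ν̃` (`rmAnchor_at_of_realMultiplication_algebraic_at`). No Hodge-conjecture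
input: the instance is unconditional in the species. [cite: VanGeemenSchuett2023, §4.8 and Rem. 4.9]
[cite: Fulton1998, §16.1] -/
theorem rmAnchor_of_swapAutomorphism
    (hmark : Huybrechts_K3_marking_exists) (hHT : Huybrechts_K3_hodgeTypes_H2)
    (hG : Grothendieck1969_supportedClasses_le_hodgeConiveau)
    (μ : OrientationFamily) (hμ : μ.HasPoincareDuality) (hS : IsK3Surface S)
    (φ ψ : S ⟶ S) (hφψ : φ ≫ ψ = 𝟙 S) (hψφ : ψ ≫ φ = 𝟙 S)
    (hφtop : ∀ z : complexBetti S (2 * 2), complexBetti.map φ (2 * 2) z = z)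
    (E₁ E₂ : complexBetti S (2 * 1)) (hE₁ : E₁ ∈ algebraicClasses S 1)
    (hE₂ : E₂ ∈ algebraicClasses S 1) (hE₁r : IsRationalClass E₁) (hE₂r : IsRationalClass E₂)
    (h11 : cupProduct (rfl : 2 * 1 + 2 * 1 = 2 * 2) E₁ E₁ = 0)
    (h22 : cupProduct (rfl : 2 * 1 + 2 * 1 = 2 * 2) E₂ E₂ = 0)
    (h12 : cupProduct (rfl : 2 * 1 + 2 * 1 = 2 * 2) E₁ E₂ ≠ 0)
    (hspan : ∀ d ∈ algebraicClasses S 1, ∃ a b : ℂ, d = a • E₁ + b • E₂)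
    (hφE₁ : complexBetti.map φ (2 * 1) E₁ = E₂) (hφE₂ : complexBetti.map φ (2 * 1) E₂ = E₁)
    (hT : ∀ x : complexBetti S (2 * 1),
      (∀ d ∈ algebraicClasses S 1, cupProduct (rfl : 2 * 1 + 2 * 1 = 2 * 2) x d = 0) →
        complexBetti.map φ (2 * 1) (complexBetti.map φ (2 * 1)
          (complexBetti.map φ (2 * 1) (complexBetti.map φ (2 * 1) x))) = -x)
    (p : complexBetti S (2 * 2))
    (hp : IsIntegralClass p ∧ ∀ q : complexBetti S (2 * 2), IsIntegralClass q → ∃ n : ℤ, q = n • p) :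
    ∃ (S'' : SchemeOver ℂ) (hS'' : IsK3Surface S'') (p'' : complexBetti S'' (2 * 2)),
      (IsIntegralClass p'' ∧
        ∀ q : complexBetti S'' (2 * 2), IsIntegralClass q → ∃ n : ℤ, q = n • p'') ∧
      ∃ Ψ : complexBetti S'' (2 * 1) ≃ₗ[ℂ] complexBetti S (2 * 1),
        (∀ y, IsRationalClass y → IsRationalClass (Ψ.symm y)) ∧
        (∀ (i j : ℕ) y, IsOfHodgeType 2 S (2 * 1) i j y →
          IsOfHodgeType 2 S'' (2 * 1) i j (Ψ.symm y)) ∧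
        (∀ (u v : complexBetti S (2 * 1)) (b : ℂ),
          cupProduct (rfl : 2 * 1 + 2 * 1 = 2 * 2) u v = ((2 : ℂ) * b) • p →
            cupProduct (rfl : 2 * 1 + 2 * 1 = 2 * 2) (Ψ.symm u) (Ψ.symm v) = b • p'') ∧
        ∃ γ ∈ algebraicClasses (S ⊗ S'') 2, ∀ x : complexBetti S'' (2 * 1),
          Ψ x = complexGysin μ (IsSmoothProjective.tensor_holds hS.1 hS''.1) hS.1 (fst S S'')
            (rfl : 2 * 1 + 2 * 2 + 2 * 2 = 2 * 1 + 2 * (2 + 2))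
            (cupProduct (rfl : 2 * 1 + 2 * 2 = 2 * 1 + 2 * 2)
              (complexBetti.map (snd S S'') (2 * 1) x) γ) := by
  obtain ⟨e, he_rat, he_type, he_adj, he_N, he_T, he_alg, -⟩ :=
    swapRealMultiplication_spec hmark hHT hG μ hμ hS φ ψ hφψ hψφ hφtop E₁ E₂ hE₁ hE₂ hE₁r hE₂r
      h11 h22 h12 hspan hφE₁ hφE₂ hT
  exact rmAnchor_at_of_realMultiplication_algebraic_at hmark hHT hG μ hμ hS p hp e he_rat he_type
    he_adj he_N he_T he_alg

end Summit.HodgeConjecture.HodgeConjecture.Theorems.NikulinTwinTransport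

end
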